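import Literature.NumberTheory.EllipticCurves.IwasawaAlgebraTwoVarGeneratorChange

/-!
# splitslice — first checkable lemma (crux idea for stmt-BirchSwinnertonDyer-20728 / F1 = `stub_ratEulerSystemSS`)

Door 5 (qtame, `Cruxes/TwoVariableEulerSystemDivisibility/QtameDoor5.lean` §E15) takes an abstract second
PATCHING DIRECTION `Θ : Λ₂ ≃+* Λ₂` whose visibility dichotomy follows (`dichotomy_of_reduction`, PROVED there)
from: `Θ` reduces mod `p` to an automorphism `Θb` of `k⟦T₂⟧⟦T₁⟧` and the reduced new line variable is not an
associate of `T₂`. splitslice feeds BOTH directions with SPLIT-PRIME frames `Θ = frameSubst ℤ_p A`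
(tree: `IwasawaAlgebra₂.frameSubst`, GL₂(ℤ_p) generator change `1+T_j ↦ (1+T₁)^{A₀ⱼ}(1+T₂)^{A₁ⱼ}`), `A` = the
coordinates of (a generator of the saturated inertia group at `v̄`, resp. at `v`) in the route's pair
`(γ₁, γ₂)`. The first lemma = the two hypotheses of `dichotomy_of_reduction` for frames: (a) frames commute
with reduction mod `p`; (b) if `A 0 1 ≠ 0` (the new second generator has a non-zero FIRST = cyclotomic
coordinate — true for an inertia generator above `p`, which surjects onto `Γ^cyc`), the reduced image of
`T₂` is not an associate of `T₂` (cf. the tree's `frameSubst_C_X_not_mem_span_iff`: `φ_A(T₂) ∉ (p, T₂) ↔ A 0 1 ≠ 0`).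
No elliptic curve, no BSD here.
-/

namespace SplitsliceSketch

open Literature.NumberTheory.EllipticCurves

variable (p : ℕ) [Fact p.Prime]

/-- (a) Frames commute with reduction modulo `p` (both sides are the substitution
`1 + T_j ↦ (1+T₁)^{A 0 j} (1+T₂)^{A 1 j}`, over `ℤ_p` resp. over `k = ℤ_p/p`). -/
def FrameReducesModP : Prop :=
  ∀ (A : GL (Fin 2) ℤ_[p]) (F : PowerSeries (PowerSeries ℤ_[p])),
    PowerSeries.map (PowerSeries.map (IsLocalRing.residue ℤ_[p]))
        (IwasawaAlgebra₂.frameSubst ℤ_[p] A F) =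
      IwasawaAlgebra₂.frameSubst (IsLocalRing.ResidueField ℤ_[p]) A
        (PowerSeries.map (PowerSeries.map (IsLocalRing.residue ℤ_[p])) F)

/-- (b) Over the residue field, the frame image of the inner variable `T₂ = C X` is NOT an associate of `T₂`
as soon as `A 0 1 ≠ 0` in `ℤ_p` (if `A 0 1 = u·p^e`, the `T₁^{p^e}`-coefficient of `φ_A(T₂) mod (p)` is
`≡ u ≢ 0`, so `T₂ ∤ φ_A(T₂)`; Lucas). This is the mod-`p` criterion's hypothesis for the frame `A⁻¹`. -/
def FrameLineVariableNotAssociated : Prop :=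
  ∀ (A : GL (Fin 2) ℤ_[p]), (A : Matrix (Fin 2) (Fin 2) ℤ_[p]) 0 1 ≠ 0 →
    ¬ Associated
      (IwasawaAlgebra₂.frameSubst (IsLocalRing.ResidueField ℤ_[p]) A
        (PowerSeries.C (PowerSeries.X : PowerSeries (IsLocalRing.ResidueField ℤ_[p]))))
      (PowerSeries.C (PowerSeries.X : PowerSeries (IsLocalRing.ResidueField ℤ_[p])))

/-- The first lemma of the line, as one statement. -/
def FirstLemma : Prop := FrameReducesModP p ∧ FrameLineVariableNotAssociated p

end SplitsliceSketch
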